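import Literature.NumberTheory.EllipticCurves.IsogenyTwoTorsionProofs
import Literature.NumberTheory.EllipticCurves.Greenberg1999.TwoTorsionMuInvariant
import HarnessLib

/-!
# The archimedean half of the h-invariant: Greenberg's «odd» type FLIPS under the explicit 2-isogeny of two-torsion normal forms

Support lemma for the crux (★-OptB_NSF) `StarOptBNSF` (item stmt-BirchSwinnertonDyer-27047, child of the load-bearing crux E1M_NSF of
route `EisensteinDepletionAtTwo`), registered line `nsf` (planner p2 GEN 31), stub `stub_regimeTransport` («h-invariant»: in the
ℚ-isogeny class of a habitat curve a globally minimal member without a formal rational 2-torsion point is of type B).  On paper the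
h-invariant `h(P) = [P formal at 2] + [P odd]` is constant along rational 2-isogenies because BOTH bits flip; the line card names the
archimedean flip as its un-written risk («the archimedean flip law is pen-and-paper (four lattice cases)»).  THIS FILE proves it in
coordinates, for the two-torsion normal form `E : y² = x³ + ax² + bx` (`[0,a,0,b,0]`, rational 2-torsion point `T = (0,0)`) and the
codomain `E' : y² = x³ − 2ax² + (a² − 4b)x` of its explicit 2-isogeny (tree `WeierstrassCurve.twoIsogenyCodomain`, whose `(0,0)` generates
the dual kernel): for `b ≠ 0`, `a² ≠ 4b` (both curves nonsingular)

  `TwoTorsionOdd [0,a,0,b,0] 0 ↔ ¬ TwoTorsionOdd [0,−2a,0,a²−4b,0] 0`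

(Greenberg's «odd» = the abscissa is the LEAST real root of the 2-division cubic, tree `Greenberg1999.TwoTorsionOdd`).  Elementary real
algebra: `T` is odd on `E` iff every real root of `r² + ar + b` is `≥ 0` iff `a² < 4b ∨ (a < 0 ∧ 0 < b)`; on `E'` iff `b < 0 ∨ (0 < a ∧ 4b < a²)`;
the two conditions are complementary.  The 2-adic half of the flip (Cartier duality `μ₂ ↔ ℤ/2` on minimal models) and the isogeny-class
walk are NOT here.  HONEST FRAMING: nothing here proves `StarOptBNSF`, E1M_NSF or BSD.
References: R. Greenberg, LNM 1716 (1999) §5 («odd», chunk p0168/p0174) [GreenbergLNM1716]; J. Silverman, AEC III.4 Example 4.5 [SilvermanAEC2009].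
-/

set_option linter.dupNamespace false
set_option autoImplicit false

open Literature.NumberTheory.EllipticCurves.Greenberg1999

namespace Summit.BirchSwinnertonDyer.BirchSwinnertonDyer.Theorems.DepletionAtTwo.ArchFlip

/-! ## §1 Two real-quadratic sign lemmas -/

/-- If `p² < 4q`, or `p < 0 < q`, every real root of `r·(r² + pr + q)` is `≥ 0` (in the first case `r² + pr + q > 0`; in the second a
negative `r` makes all three terms of `r² + pr + q` positive). [folklore] -/
theorem nonneg_of_root_of_sign {p q : ℝ} (h : p ^ 2 < 4 * q ∨ (p < 0 ∧ 0 < q)) {r : ℝ} (hr : r * (r ^ 2 + p * r + q) = 0) :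
    0 ≤ r := by
  rcases mul_eq_zero.mp hr with h0 | hq
  · exact h0.symm.le
  · by_contra hneg
    push Not at hneg
    rcases h with h1 | ⟨hp, hq0⟩
    · nlinarith [sq_nonneg (2 * r + p)]
    · nlinarith [mul_pos_of_neg_of_neg hp hneg]

/-- If `q < 0`, or `0 < p` and `4q ≤ p²`, then `r² + pr + q` has a NEGATIVE real root, namely `r₋ = (−p − √(p² − 4q))/2`. [folklore] -/
theorem exists_neg_root_of_sign {p q : ℝ} (h : q < 0 ∨ (0 < p ∧ 4 * q ≤ p ^ 2)) :
    ∃ r : ℝ, r < 0 ∧ r ^ 2 + p * r + q = 0 := by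
  have hD : 0 ≤ p ^ 2 - 4 * q := by
    rcases h with hq | ⟨-, hpq⟩
    · nlinarith [sq_nonneg p]
    · linarith
  set s : ℝ := Real.sqrt (p ^ 2 - 4 * q) with hs
  have hs0 : 0 ≤ s := Real.sqrt_nonneg _
  have hs2 : s ^ 2 = p ^ 2 - 4 * q := by rw [hs, Real.sq_sqrt hD]
  refine ⟨(-p - s) / 2, ?_, ?_⟩
  · -- `−p < s`: if `0 < p` trivially; if `q < 0` then `s² > p²`, so `s > −p`
    have hlt : -p < s := by
      rcases h with hq | ⟨hp, -⟩
      · by_contra hle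
        push Not at hle
        have h1 : 0 ≤ -p - s := sub_nonneg.mpr hle
        have h2 : 0 ≤ -p + s := by linarith
        nlinarith [mul_nonneg h1 h2, hs2]
      · linarith
    linarith
  · nlinarith [hs2]

/-- **All real roots of `r(r² + pr + q)` are `≥ 0` iff `p² < 4q` or `p < 0 < q`** (for `q ≠ 0`, `p² ≠ 4q`). [folklore] -/
theorem allRootsNonneg_iff {p q : ℝ} (hq : q ≠ 0) (hD : p ^ 2 ≠ 4 * q) :
    (∀ r : ℝ, r * (r ^ 2 + p * r + q) = 0 → 0 ≤ r) ↔ (p ^ 2 < 4 * q ∨ (p < 0 ∧ 0 < q)) := by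
  constructor
  · intro H
    by_contra hnot
    push Not at hnot
    obtain ⟨h1, h2⟩ := hnot
    have hD' : 4 * q < p ^ 2 := lt_of_le_of_ne h1 (Ne.symm hD)
    -- a negative root exists: either `q < 0`, or `q > 0` and then `p > 0` (as `p < 0` is excluded by `h2` and `p = 0` by `4q < p²`)
    have hsign : q < 0 ∨ (0 < p ∧ 4 * q ≤ p ^ 2) := by
      rcases lt_or_gt_of_ne hq with hq0 | hq0
      · exact Or.inl hq0
      · right
        refine ⟨?_, hD'.le⟩
        rcases lt_trichotomy p 0 with hp | hp | hp
        · exact absurd hq0 (not_lt.mpr (h2 hp))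
        · subst hp; nlinarith
        · exact hp
    obtain ⟨r, hr, hroot⟩ := exists_neg_root_of_sign hsign
    have := H r (by rw [hroot, mul_zero])
    linarith
  · intro h r hr
    exact nonneg_of_root_of_sign h hr

/-! ## §2 Greenberg's «odd» for two-torsion normal forms -/

/-- For a Weierstrass curve over `ℚ` with `b₂ = 4c₂`, `b₄ = 2c₄`, `b₆ = 0` (e.g. a two-torsion normal form `[0,c₂,0,c₄,0]`), the
2-division cubic is `4·r(r² + c₂r + c₄)`, so `TwoTorsionOdd W 0` says that all its real roots are `≥ 0`.
[cite: GreenbergLNM1716, §5 (chunk p0168) and Remark (chunk p0174)] -/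
theorem twoTorsionOdd_zero_iff_of_b {W : WeierstrassCurve ℚ} {c₂ c₄ : ℚ} (h2 : W.b₂ = 4 * c₂) (h4 : W.b₄ = 2 * c₄)
    (h6 : W.b₆ = 0) :
    TwoTorsionOdd W 0 ↔ ∀ r : ℝ, r * (r ^ 2 + (c₂ : ℝ) * r + (c₄ : ℝ)) = 0 → 0 ≤ r := by
  unfold TwoTorsionOdd
  rw [h2, h4, h6]
  push_cast
  constructor
  · intro H r hr
    exact H r (by linear_combination 4 * hr)
  · intro H r hr
    exact H r (by linear_combination (1 / 4 : ℝ) * hr)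

/-- **`T = (0,0)` is odd on `E = [0,a,0,b,0]` iff `a² < 4b ∨ (a < 0 ∧ 0 < b)`** (`b ≠ 0`, `a² ≠ 4b`).
[cite: GreenbergLNM1716, §5 Remark (chunk p0174)] -/
theorem twoTorsionOdd_zero_nf_iff (a b : ℚ) (hb : b ≠ 0) (hD : a ^ 2 ≠ 4 * b) :
    TwoTorsionOdd (⟨0, a, 0, b, 0⟩ : WeierstrassCurve ℚ) 0 ↔ (a ^ 2 < 4 * b ∨ (a < 0 ∧ 0 < b)) := by
  have h2 : (⟨0, a, 0, b, 0⟩ : WeierstrassCurve ℚ).b₂ = 4 * a := by simp [WeierstrassCurve.b₂]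
  have h4 : (⟨0, a, 0, b, 0⟩ : WeierstrassCurve ℚ).b₄ = 2 * b := by simp [WeierstrassCurve.b₄]
  have h6 : (⟨0, a, 0, b, 0⟩ : WeierstrassCurve ℚ).b₆ = 0 := by simp [WeierstrassCurve.b₆]
  rw [twoTorsionOdd_zero_iff_of_b h2 h4 h6,
    allRootsNonneg_iff (by exact_mod_cast hb) (by exact_mod_cast hD)]
  norm_cast

/-- **`T' = (0,0)` is odd on the 2-isogenous `E' = [0,−2a,0,a²−4b,0]` iff `b < 0 ∨ (0 < a ∧ 4b < a²)`** (`b ≠ 0`, `a² ≠ 4b`).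
[cite: SilvermanAEC2009, III.4 Example 4.5] -/
theorem twoTorsionOdd_zero_twoIsogenyCodomain_iff (a b : ℚ) (hb : b ≠ 0) (hD : a ^ 2 ≠ 4 * b) :
    TwoTorsionOdd (WeierstrassCurve.twoIsogenyCodomain (⟨0, a, 0, b, 0⟩ : WeierstrassCurve ℚ)) 0 ↔
      (b < 0 ∨ (0 < a ∧ 4 * b < a ^ 2)) := by
  have hE : WeierstrassCurve.twoIsogenyCodomain (⟨0, a, 0, b, 0⟩ : WeierstrassCurve ℚ) = ⟨0, -2 * a, 0, a ^ 2 - 4 * b, 0⟩ := rfl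
  have h2 : (⟨0, -2 * a, 0, a ^ 2 - 4 * b, 0⟩ : WeierstrassCurve ℚ).b₂ = 4 * (-2 * a) := by simp [WeierstrassCurve.b₂]
  have h4 : (⟨0, -2 * a, 0, a ^ 2 - 4 * b, 0⟩ : WeierstrassCurve ℚ).b₄ = 2 * (a ^ 2 - 4 * b) := by
    simp [WeierstrassCurve.b₄]
  have h6 : (⟨0, -2 * a, 0, a ^ 2 - 4 * b, 0⟩ : WeierstrassCurve ℚ).b₆ = 0 := by simp [WeierstrassCurve.b₆]
  rw [hE, twoTorsionOdd_zero_iff_of_b h2 h4 h6]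
  have hq : ((a ^ 2 - 4 * b : ℚ) : ℝ) ≠ 0 := by exact_mod_cast sub_ne_zero.mpr hD
  have hD' : ((-2 * a : ℚ) : ℝ) ^ 2 ≠ 4 * ((a ^ 2 - 4 * b : ℚ) : ℝ) := by
    push_cast
    intro h
    apply hb
    have : ((b : ℚ) : ℝ) = 0 := by linarith
    exact_mod_cast this
  rw [allRootsNonneg_iff hq hD']
  push_cast
  constructor
  · rintro (h | ⟨h1, h2⟩)
    · left; exact_mod_cast (show ((b : ℚ) : ℝ) < 0 by linarith)
    · right
      exact ⟨by exact_mod_cast (show (0 : ℝ) < a by linarith), by exact_mod_cast (show (4 : ℝ) * b < (a : ℝ) ^ 2 by linarith)⟩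
  · rintro (h | ⟨h1, h2⟩)
    · left
      have : ((b : ℚ) : ℝ) < 0 := by exact_mod_cast h
      linarith
    · right
      have h1' : (0 : ℝ) < a := by exact_mod_cast h1
      have h2' : (4 : ℝ) * b < (a : ℝ) ^ 2 := by exact_mod_cast h2
      exact ⟨by linarith, by linarith⟩

/-! ## §3 The flip -/

/-- **ARCHIMEDEAN FLIP OF THE h-INVARIANT.**  For the two-torsion normal form `E = [0,a,0,b,0]` (`b ≠ 0`, `a² ≠ 4b`) and the codomain
`E' = twoIsogenyCodomain E = [0,−2a,0,a²−4b,0]` of its explicit 2-isogeny (whose `(0,0)` generates the dual kernel): the kernel point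
`(0,0)` is odd on `E` iff `(0,0)` is NOT odd on `E'`. [cite: GreenbergLNM1716, §5 Remark (chunk p0174)] [cite: SilvermanAEC2009, III.4 Example 4.5] -/
theorem twoTorsionOdd_zero_iff_not_twoIsogenyCodomain (a b : ℚ) (hb : b ≠ 0) (hD : a ^ 2 ≠ 4 * b) :
    TwoTorsionOdd (⟨0, a, 0, b, 0⟩ : WeierstrassCurve ℚ) 0 ↔
      ¬ TwoTorsionOdd (WeierstrassCurve.twoIsogenyCodomain (⟨0, a, 0, b, 0⟩ : WeierstrassCurve ℚ)) 0 := by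
  rw [twoTorsionOdd_zero_nf_iff a b hb hD, twoTorsionOdd_zero_twoIsogenyCodomain_iff a b hb hD]
  constructor
  · rintro (h | ⟨h1, h2⟩) (h' | ⟨h1', h2'⟩)
    · nlinarith [sq_nonneg a]
    · linarith
    · linarith
    · linarith
  · intro h
    push Not at h
    obtain ⟨hb0, himp⟩ := h
    have hb' : 0 < b := lt_of_le_of_ne hb0 (Ne.symm hb)
    rcases lt_or_gt_of_ne hD with hlt | hgt
    · exact Or.inl hlt
    · right
      refine ⟨?_, hb'⟩
      rcases lt_trichotomy a 0 with ha | ha | ha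
      · exact ha
      · subst ha; nlinarith
      · exact absurd (himp ha) (not_le.mpr hgt)

end Summit.BirchSwinnertonDyer.BirchSwinnertonDyer.Theorems.DepletionAtTwo.ArchFlip
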